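import Summits.HubbardSuperconductivity.HubbardSuperconductivity.Theorems.AnisotropyChordTransferFibre3KT2aRow
import Summits.HubbardSuperconductivity.HubbardSuperconductivity.Theorems.AnisotropyChordTransferFibre3RowCPsi
import Summits.HubbardSuperconductivity.HubbardSuperconductivity.Theorems.AnisotropyChordTransferFibre3TwoMagnon

/-!
# Route `AnisotropyChord` / H0 rotor rung: PartN41-D §3–§5 — the small Fourier lemmas (`DgradTransform`, `ShiftTransform`, `SlotsEvenZero` PROVED)

Theory-1 g22's PartN41-D (port …Fibre3KT2aRow): ★ `dgradTransform_holds : DgradTransform L`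
(`FT[D_e F](q) = (1 − e^{−iq·e})F̂(q)`, = `RowC.dft_Dgrad`), ★ `shiftTransform_holds : ShiftTransform L`
(`FT[G(· − e)] = e^{−iq·e}Ĝ`, `FT[G(· + e)] = e^{iq·e}Ĝ`; `OuterMaj.dft_shift_sub`, `dft_shift`), ★ `slotsEvenZero_holds (Δ) :
SlotsEvenZero L Δ` (the slot profiles `f_JU`, `f_S` of an even profile vanishing at the origin are even and vanish at the origin).
Prover seat `hubbard-h0-rotor-p1` g27 (route lead); helper for stmt-HubbardSuperconductivity-23918 (`--supports`, helper class).
WHAT THIS IS NOT: nothing here proves superconductivity in the Hubbard model.  Tree imports only; no new definitions; no sorry.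
-/

set_option linter.dupNamespace false
set_option autoImplicit false

noncomputable section

open scoped BigOperators

namespace Summit.HubbardSuperconductivity.HubbardSuperconductivity.Theorems.AnisotropyChord.Transfer.Fibre3

variable (L : ℕ) [NeZero L]

/-- ★ **`DgradTransform L` holds.** [folklore] -/
theorem dgradTransform_holds : DgradTransform L := by
  intro F e q
  exact RowC.dft_Dgrad L F e q

/-- ★ **`ShiftTransform L` holds.** [folklore] -/
theorem shiftTransform_holds : ShiftTransform L := by
  intro G e q
  refine ⟨OuterMaj.dft_shift_sub L G q e, ?_⟩
  have h := dft_shift L G q e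
  unfold dft
  exact h

omit [NeZero L] in
/-- ★ **`SlotsEvenZero L Δ` holds.** [folklore] -/
theorem slotsEvenZero_holds (Δ : ℝ) : SlotsEvenZero L Δ := by
  intro f heven h0
  refine ⟨fun r => ?_, fun r => ?_, ?_, ?_⟩
  · unfold fJU; simp only [neg_eq_zero]
  · unfold fS fJU; simp only [neg_eq_zero, heven]
  · unfold fJU; simp
  · unfold fS fJU; simp [h0]

end Summit.HubbardSuperconductivity.HubbardSuperconductivity.Theorems.AnisotropyChord.Transfer.Fibre3

end
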